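import Literature.NumberTheory.DiophantineGeometry.KroneckerHeightZero
import Mathlib.NumberTheory.Height.NumberField
import Mathlib.Data.Nat.Prime.Infinite
import HarnessLib

set_option linter.dupNamespace false

/-!
# Route `route-ABC-IUTThetaPilot`, support item `GenEllTwo` (stmt-ABC-19679) — helper.
# [GenEll] Thm. 2.1, (ii) ⇒ (i): the menu covering lemma — PRIME MENUS and the OUTER (power-map) persistence

S. Mochizuki, *Arithmetic elliptic curves in general position*, Math. J. Okayama Univ. **52** (2010)
[cite: MochizukiGenEll2010], proof of Thm. 2.1 p. 12 (number-field-only architecture, package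
GENELLTWO-P1ROUTE §4, cell abc-iut): the OUTER family of the depth-2 menu is the power family
`y ↦ y^p`, `p` ranging over a finite menu `PA` of primes.  Its PERSISTENCE property — the
algebraic input (h1) of `MenuCovering.exists_radii` — says: for distinct `p, p' ∈ PA` and a finite
bad set `X` of nonzero algebraic numbers (sitting in a number field `K₀`, read in any field `E` of
characteristic zero through `τ : K₀ →+* E`), a point `y ∈ E` with `y^p ∈ τ(X)` and `y^{p'} ∈ τ(X)`
lies in the finite PERSISTENT set `τ(T)`, `T := {y₀ ∈ K₀ torsion | ∃ p ∈ PA, y₀^p ∈ X}`,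
PROVIDED the menu grows geometrically with ratio exceeding every quotient of positive heights
`h(a)/h(a')`, `a, a' ∈ X` (Kronecker's theorem, tree file `KroneckerHeightZero`: `y^p = a`,
`y^{p'} = a'` give `p'·h(a) = p·h(a')`, so either the ratio condition is violated or `h(a) = 0`,
i.e. `a` is a root of unity, and then so is `y`; and `y = (y^p)^u (y^{p'})^v ∈ τ(K₀)` by Bézout).

Contents (theorems only, no definitions):
* `exists_prime_menu` — menus of any size of primes above any bound with prescribed geometric
  growth (Euclid);
* `exists_ratio_bound` — a bound `R ≥ 1` for all quotients of positive values of a real function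
  on a finite set;
* `logHeight₁_eq_zero_of_menu` — the height bookkeeping: `p'·h(a) = p·h(a')`, `p ≠ p'` in a menu
  of growth `> R ≥ h(a)/h(a')` forces `h(a) = 0`;
* `outer_persistence` — the persistence property above, in any field `E` of characteristic zero;
* `finite_outerPersistent` — finiteness of `T`.

Classical and undisputed; nothing here bears on [IUTchIII] Cor. 3.12.
-/

noncomputable section

open NumberField Height Polynomial

namespace Summit.ABC.ABC.Theorems.GenEllTwo.MenuCovering

/-! ## Prime menus with geometric growth -/

/-- **Prime menus.** For every real `R`, bound `N₀` and size `m` there is a set of `m` primes, all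
`≥ N₀`, any two of which (in increasing order) grow by a factor `> R`. [folklore] -/
theorem exists_prime_menu (R : ℝ) (N₀ m : ℕ) :
    ∃ PA : Finset ℕ, PA.card = m ∧ (∀ p ∈ PA, p.Prime ∧ N₀ ≤ p) ∧
      ∀ p ∈ PA, ∀ p' ∈ PA, p < p' → R * p < p' := by
  induction m with
  | zero => exact ⟨∅, by simp, by simp, by simp⟩
  | succ m ih =>
    obtain ⟨PA, hcard, hprime, hgrow⟩ := ih
    -- a prime beyond `N₀`, beyond every element of `PA` and beyond `R ·` every element of `PA`
    obtain ⟨q, hqge, hq⟩ := Nat.exists_infinite_primes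
      (N₀ + ∑ p ∈ PA, p + ⌈max R 0⌉₊ * (∑ p ∈ PA, p) + 1)
    have hqnot : q ∉ PA := by
      intro hq'
      have : q ≤ ∑ p ∈ PA, p := Finset.single_le_sum (fun p _ => Nat.zero_le p) hq'
      omega
    refine ⟨insert q PA, by rw [Finset.card_insert_of_notMem hqnot, hcard], ?_, ?_⟩
    · intro p hp
      rcases Finset.mem_insert.mp hp with rfl | hp
      · exact ⟨hq, by omega⟩
      · exact hprime p hp
    · intro p hp p' hp' hlt
      rcases Finset.mem_insert.mp hp' with h1 | h1
      · -- `p' = q` is the new prime, `p` an old one (or `q` itself, excluded by `p < q`)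
        subst h1
        rcases Finset.mem_insert.mp hp with h2 | h2
        · subst h2; exact absurd hlt (lt_irrefl _)
        · have hple : p ≤ ∑ p ∈ PA, p := Finset.single_le_sum (fun p _ => Nat.zero_le p) h2
          have h1 : R * p ≤ max R 0 * p :=
            mul_le_mul_of_nonneg_right (le_max_left _ _) (Nat.cast_nonneg _)
          have h2 : max R 0 * (p : ℝ) ≤ (⌈max R 0⌉₊ : ℝ) * (∑ p ∈ PA, p : ℕ) := by
            have : (max R 0 : ℝ) ≤ ⌈max R 0⌉₊ := Nat.le_ceil _
            have hp' : (p : ℝ) ≤ ((∑ p ∈ PA, p : ℕ) : ℝ) := by exact_mod_cast hple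
            exact mul_le_mul this hp' (Nat.cast_nonneg _) (le_trans (le_max_right _ _) this)
          have h3 : ((⌈max R 0⌉₊ : ℕ) : ℝ) * ((∑ p ∈ PA, p : ℕ) : ℝ) < p' := by
            have : ⌈max R 0⌉₊ * (∑ p ∈ PA, p) < p' := by omega
            exact_mod_cast this
          linarith
      · rcases Finset.mem_insert.mp hp with h2 | h2
        · -- `p = q` new, `p'` old: impossible since `q` exceeds every old element
          subst h2
          have : p' ≤ ∑ p ∈ PA, p := Finset.single_le_sum (fun p _ => Nat.zero_le p) h1
          omega
        · exact hgrow p h2 p' h1 hlt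

/-- In a menu with growth factor `> R ≥ 1`, ANY two distinct members `p < p'` satisfy `R·p < p'`
(immediate from the pairwise statement; recorded with the ratio form used below): if
`p'·A = p·B` with `0 < A`, `0 ≤ B ≤ R·A`... see `logHeight₁_eq_zero_of_menu`. [folklore] -/
theorem ratio_lt_of_menu {PA : Finset ℕ} {R : ℝ}
    (hgrow : ∀ p ∈ PA, ∀ p' ∈ PA, p < p' → R * p < p') {p p' : ℕ} (hp : p ∈ PA) (hp' : p' ∈ PA)
    (hne : p ≠ p') {A B : ℝ} (hA : 0 < A) (hB : 0 < B) (hAB : B ≤ R * A) (hBA : A ≤ R * B)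
    (h : (p' : ℝ) * A = p * B) : False := by
  rcases lt_or_gt_of_ne hne with hlt | hlt
  · -- `p < p'`: `R p < p'`, so `R p A < p' A = p B ≤ p R A`
    have h1 : R * p * A < p' * A := mul_lt_mul_of_pos_right (hgrow p hp p' hp' hlt) hA
    have h2 : (p : ℝ) * B ≤ p * (R * A) := mul_le_mul_of_nonneg_left hAB (Nat.cast_nonneg _)
    nlinarith
  · have h1 : R * p' * B < p * B := mul_lt_mul_of_pos_right (hgrow p' hp' p hp hlt) hB
    have h2 : (p' : ℝ) * A ≤ p' * (R * B) := mul_le_mul_of_nonneg_left hBA (Nat.cast_nonneg _)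
    nlinarith

/-- A positive function on a finite set has a positive lower bound. [folklore] -/
private theorem exists_pos_forall_le' {α : Type*} {S : Set α} (hS : S.Finite) (g : α → ℝ)
    (hg : ∀ y ∈ S, 0 < g y) : ∃ c > 0, ∀ y ∈ S, c ≤ g y := by
  induction S, hS using Set.Finite.induction_on with
  | empty => exact ⟨1, one_pos, fun y hy => hy.elim⟩
  | @insert a s _ _ ih =>
    obtain ⟨c, hc, hcs⟩ := ih (fun y hy => hg y (Set.mem_insert_of_mem _ hy))
    refine ⟨min c (g a), lt_min hc (hg a (Set.mem_insert _ _)), fun y hy => ?_⟩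
    rcases Set.mem_insert_iff.mp hy with rfl | hy
    · exact min_le_right _ _
    · exact (min_le_left _ _).trans (hcs y hy)

/-- **Ratio bound.** For a real function `h ≥ 0` on a finite set `X` there is `R ≥ 1` with
`h a ≤ R · h a'` whenever `a, a' ∈ X` and `0 < h a'`. [folklore] -/
theorem exists_ratio_bound {α : Type*} (X : Finset α) (h : α → ℝ) (hnn : ∀ a ∈ X, 0 ≤ h a) :
    ∃ R : ℝ, 1 ≤ R ∧ ∀ a ∈ X, ∀ a' ∈ X, 0 < h a' → h a ≤ R * h a' := by
  have hfin : {a | a ∈ X ∧ 0 < h a}.Finite := Set.Finite.subset X.finite_toSet fun a ha => ha.1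
  obtain ⟨c, hc, hcle⟩ := exists_pos_forall_le' hfin h (fun a ha => ha.2)
  set M : ℝ := ∑ a ∈ X, h a with hM
  have hM0 : 0 ≤ M := Finset.sum_nonneg hnn
  refine ⟨max 1 (M / c), le_max_left _ _, fun a ha a' ha' hpos => ?_⟩
  have h1 : h a ≤ M := Finset.single_le_sum hnn ha
  have h2 : c ≤ h a' := hcle a' ⟨ha', hpos⟩
  have h3 : M ≤ M / c * h a' := by
    rw [div_mul_eq_mul_div, le_div_iff₀ hc]
    exact mul_le_mul_of_nonneg_left h2 hM0
  calc h a ≤ M := h1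
    _ ≤ M / c * h a' := h3
    _ ≤ max 1 (M / c) * h a' := mul_le_mul_of_nonneg_right (le_max_right _ _) hpos.le

/-! ## The outer (power-map) persistence -/

section Outer

variable {K₀ : Type*} [Field K₀] [NumberField K₀]

/-- **Height bookkeeping for the power menu.** If `p ≠ p'` lie in a menu whose growth factor `R`
dominates all quotients of positive heights on `X`, and `a, a' ∈ X` satisfy `p'·h(a) = p·h(a')`,
then `h(a) = 0`. [cite: MochizukiGenEll2010, Thm 2.1 p.12] -/
theorem logHeight₁_eq_zero_of_menu {X : Finset K₀} {R : ℝ}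
    (hR : ∀ a ∈ X, ∀ a' ∈ X, 0 < logHeight₁ a' → logHeight₁ a ≤ R * logHeight₁ a')
    {PA : Finset ℕ} (hgrow : ∀ p ∈ PA, ∀ p' ∈ PA, p < p' → R * p < p')
    {p p' : ℕ} (hp : p ∈ PA) (hp' : p' ∈ PA) (hne : p ≠ p') {a a' : K₀} (ha : a ∈ X)
    (ha' : a' ∈ X) (h : (p' : ℝ) * logHeight₁ a = p * logHeight₁ a')
    (hp'0 : 0 < p') : logHeight₁ a = 0 := by
  by_contra hA
  have hA : 0 < logHeight₁ a := lt_of_le_of_ne (zero_le_logHeight₁ a) (Ne.symm hA)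
  have hB : 0 < logHeight₁ a' := by
    have : 0 < (p' : ℝ) * logHeight₁ a := mul_pos (by exact_mod_cast hp'0) hA
    rw [h] at this
    exact pos_of_mul_pos_right this (Nat.cast_nonneg _)
  exact ratio_lt_of_menu hgrow hp hp' hne hA hB (hR a' ha' a ha hA) (hR a ha a' ha' hB) h

/-- **OUTER PERSISTENCE of the power family** (hypothesis (h1) of `MenuCovering.exists_radii` for
`f_p : y ↦ y^p`).  `K₀` a number field, `X ⊂ K₀` finite with `0 ∉ X`, `PA` a menu of primes with
growth factor `R` dominating the height quotients on `X`; `E` any field of characteristic zero,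
`τ : K₀ →+* E`.  If `y ∈ E` has `y^p ∈ τ(X)` and `y^{p'} ∈ τ(X)` for distinct `p, p' ∈ PA`, then
`y = τ(y₀)` for a ROOT OF UNITY `y₀ ∈ K₀` with `y₀^p ∈ X` (Bézout: `y = (y^p)^u (y^{p'})^v`; Kronecker:
`p'·h(a) = p·h(a')` forces `h(a) = 0`). [cite: MochizukiGenEll2010, Thm 2.1 p.12] -/
theorem outer_persistence {X : Finset K₀} (h0 : (0 : K₀) ∉ X) {R : ℝ}
    (hR : ∀ a ∈ X, ∀ a' ∈ X, 0 < logHeight₁ a' → logHeight₁ a ≤ R * logHeight₁ a')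
    {PA : Finset ℕ} (hprime : ∀ p ∈ PA, p.Prime)
    (hgrow : ∀ p ∈ PA, ∀ p' ∈ PA, p < p' → R * p < p')
    {E : Type*} [Field E] (τ : K₀ →+* E)
    {p p' : ℕ} (hp : p ∈ PA) (hp' : p' ∈ PA) (hne : p ≠ p') {y : E}
    (hy : y ^ p ∈ τ '' (X : Set K₀)) (hy' : y ^ p' ∈ τ '' (X : Set K₀)) :
    ∃ y₀ : K₀, IsOfFinOrder y₀ ∧ y₀ ^ p ∈ X ∧ τ y₀ = y := by
  obtain ⟨a, ha, hya⟩ := hy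
  obtain ⟨a', ha', hya'⟩ := hy'
  have hpP : p.Prime := hprime p hp
  have hpP' : p'.Prime := hprime p' hp'
  have ha0 : a ≠ 0 := fun h => h0 (h ▸ ha)
  have ha'0 : a' ≠ 0 := fun h => h0 (h ▸ ha')
  have hy0 : y ≠ 0 := by
    intro h
    rw [h, zero_pow hpP.ne_zero] at hya
    exact ha0 (τ.injective (by rw [hya, map_zero]))
  -- Bézout: `u p + v p' = 1`
  have hcop : IsCoprime (p : ℤ) (p' : ℤ) :=
    Nat.isCoprime_iff_coprime.mpr ((Nat.coprime_primes hpP hpP').mpr hne)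
  obtain ⟨u, v, huv⟩ := hcop
  -- the candidate `y₀ := a^u a'^v`
  refine ⟨a ^ u * a' ^ v, ?_, ?_, ?_⟩
  rotate_left 2
  · -- `τ y₀ = y`
    have : τ (a ^ u * a' ^ v) = (y ^ p) ^ u * (y ^ p') ^ v := by
      rw [map_mul, map_zpow₀, map_zpow₀, hya, hya']
    rw [this, ← zpow_natCast, ← zpow_natCast, ← zpow_mul, ← zpow_mul, ← zpow_add₀ hy0]
    have : (p : ℤ) * u + (p' : ℤ) * v = 1 := by linarith [huv]
    rw [this, zpow_one]
  · -- `y₀` is torsion: `y₀^p = a` and `y₀^{p'} = a'` give `p' h(a) = p h(a')`, so `h(a) = 0`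
    have hτy₀ : τ (a ^ u * a' ^ v) = y := by
      have : τ (a ^ u * a' ^ v) = (y ^ p) ^ u * (y ^ p') ^ v := by
        rw [map_mul, map_zpow₀, map_zpow₀, hya, hya']
      rw [this, ← zpow_natCast, ← zpow_natCast, ← zpow_mul, ← zpow_mul, ← zpow_add₀ hy0]
      have : (p : ℤ) * u + (p' : ℤ) * v = 1 := by linarith [huv]
      rw [this, zpow_one]
    have h1 : (a ^ u * a' ^ v) ^ p = a := τ.injective (by rw [map_pow, hτy₀, hya])
    have h2 : (a ^ u * a' ^ v) ^ p' = a' := τ.injective (by rw [map_pow, hτy₀, hya'])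
    have hh : (p' : ℝ) * logHeight₁ a = p * logHeight₁ a' :=
      Literature.NumberTheory.DiophantineGeometry.mul_logHeight₁_eq_of_pow_eq h1 h2
    have hha : logHeight₁ a = 0 :=
      logHeight₁_eq_zero_of_menu hR hgrow hp hp' hne ha ha' hh hpP'.pos
    have hator : IsOfFinOrder a :=
      (Literature.NumberTheory.DiophantineGeometry.logHeight₁_eq_zero_iff_isOfFinOrder ha0).mp hha
    -- `y₀^p = a` torsion ⇒ `y₀` torsion
    rw [isOfFinOrder_iff_pow_eq_one] at hator ⊢
    obtain ⟨m, hm, ham⟩ := hator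
    exact ⟨p * m, Nat.mul_pos hpP.pos hm, by rw [pow_mul, h1, ham]⟩
  · -- `y₀^p = a ∈ X`
    have hτy₀ : τ (a ^ u * a' ^ v) = y := by
      have : τ (a ^ u * a' ^ v) = (y ^ p) ^ u * (y ^ p') ^ v := by
        rw [map_mul, map_zpow₀, map_zpow₀, hya, hya']
      rw [this, ← zpow_natCast, ← zpow_natCast, ← zpow_mul, ← zpow_mul, ← zpow_add₀ hy0]
      have : (p : ℤ) * u + (p' : ℤ) * v = 1 := by linarith [huv]
      rw [this, zpow_one]
    have h1 : (a ^ u * a' ^ v) ^ p = a := τ.injective (by rw [map_pow, hτy₀, hya])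
    rw [h1]; exact ha

omit [NumberField K₀] in
/-- The persistent set `T = {y₀ torsion | ∃ p ∈ PA, y₀^p ∈ X}` of the power menu is FINITE (it lies
in the union of the root sets of the polynomials `Y^p − a`, `p ∈ PA`, `a ∈ X`). [folklore] -/
theorem finite_outerPersistent (X : Finset K₀) (PA : Finset ℕ) (hpos : ∀ p ∈ PA, 0 < p) :
    {y₀ : K₀ | IsOfFinOrder y₀ ∧ ∃ p ∈ PA, y₀ ^ p ∈ X}.Finite := by
  classical
  have hsub : {y₀ : K₀ | IsOfFinOrder y₀ ∧ ∃ p ∈ PA, y₀ ^ p ∈ X} ⊆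
      ⋃ p ∈ PA, ⋃ a ∈ X, ((Polynomial.X ^ p - Polynomial.C a : K₀[X]).roots.toFinset : Set K₀) := by
    rintro y ⟨-, p, hp, hy⟩
    refine Set.mem_biUnion hp (Set.mem_biUnion hy ?_)
    have hne : (Polynomial.X ^ p - Polynomial.C (y ^ p) : K₀[X]) ≠ 0 :=
      X_pow_sub_C_ne_zero (hpos p hp) _
    simp only [Finset.mem_coe, Multiset.mem_toFinset, mem_roots hne, IsRoot.def, eval_sub,
      eval_pow, eval_X, eval_C, sub_self]
  refine Set.Finite.subset ?_ hsub
  exact Set.Finite.biUnion PA.finite_toSet fun p _ =>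
    Set.Finite.biUnion X.finite_toSet fun a _ => Finset.finite_toSet _

end Outer

end Summit.ABC.ABC.Theorems.GenEllTwo.MenuCovering

end
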